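import Literature.Topology.FourManifolds.SlideSetup3
import Literature.Topology.FourManifolds.SlideCurvesK2a
import HarnessLib

/-!
# The finger knot in the slab: the twisted height along the band height is strictly decreasing

Topic `Literature/Topology/FourManifolds`; fact seat `provefact-IsStrictHandleSlide.isSurgery`
(R. C. Kirby, *The Topology of 4-Manifolds*, LNM 1374 (1989), Ch. I §4, Fig. 4.2; remaining content:
the named fact (S) `Literature.Topology.FourManifolds.FramedLink.IsStrictHandleSlide.slideModel`).
The finger knot `K₁` meets the meridian slab of the slide along the band height `h`; its point at
height `h` has slice radius `rstar h` (`K1Loop2Data`) and slice angle `Θlo h` relative to the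
axis, hence twisted height `yF h = rstar h · sin (twistAngle tw (rstar h) (Θlo h))`
(`BandCore.SlideChoice.yF`). On `[h_D, h_A]` this is the lower fingertip height
(`FingerBand.strictAntiOn_fingerY`, `rstar = rsl`), on `[h_A, h_Dᵘ]` the upper one
(`FingerBandUp`, `rstar = rsu`); both have negative derivative. With `yF` smooth near the tips
(`contDiffAt_yF`) the derivative stays negative on stubs beyond them; altogether `yF` has negative
derivative and is strictly decreasing on `[h_D - η, h_Dᵘ + η]` for some `η > 0` (`yF_strictAnti`),
with `yF h_D = r_D`, `yF h_Dᵘ = -r_Dᵘ`.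

## References

* R. C. Kirby, *The Topology of 4-Manifolds*, LNM 1374, Springer (1989), Ch. I §4. [Kirby1989]
-/

open scoped Topology ContDiff
open Set Real Filter

noncomputable section

namespace Literature.Topology.FourManifolds

namespace BandCore

variable {A B : Knot} {avoid : Set (Metric.sphere (0 : EuclideanSpace ℝ (Fin 4)) 1)} {c : BandCore A B avoid}

namespace SlideChoice

variable {e : ℝ → ℝ} (P : c.SlideChoice e) (he : ContDiffOn ℝ ∞ e (Ioo (10⁻¹ : ℝ) (9 / 10)))

/-- **The twisted height of the finger knot at band height `h`.** [folklore] -/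
def yF (h : ℝ) : ℝ := (P.loop2 he).rstar h * sin (twistAngle P.tw ((P.loop2 he).rstar h) (P.Θlo h))

/-! ### Strict clamps around the axis -/

/-- `hcl_lt_hA` (auxiliary). [folklore] -/
theorem hcl_lt_hA : (P.loop2 he).hcl < P.hA := by
  show P.hD + (1 + P.dl.κD * e P.hD - (P.Mρ * P.emax + P.Me) * P.βc - (1 + P.κD * P.emin / 4)) / P.lam < P.hA
  rw [dl_κD]
  have h1 : (P.Mρ * P.emax + P.Me) * P.βc = P.κD * P.emin / 4 := P.smaxc_mul_βc
  have e2 := (P.e_bounds _ P.hD_win).2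
  have hb : (1 + P.κD * e P.hD - P.κD * P.emin / 4 - (1 + P.κD * P.emin / 4)) / P.lam ≤ P.κD * P.emax / P.lam :=
    div_le_div_of_nonneg_right (by nlinarith [P.κD_pos, P.emin_pos]) P.lam_pos.le
  rw [h1]; linarith [P.κD_emax_div_lam_le, P.half_lt_full, P.hA_sub_hD_ge]

/-- `hA_lt_hclu` (auxiliary). [folklore] -/
theorem hA_lt_hclu : P.hA < (P.loop2 he).hclu := by
  show P.hA < P.hDu - (1 + P.du.κD * e P.hDu - (P.Mρ * P.emax + P.Me) * P.βc - (1 + P.κD * P.emin / 4)) / P.lam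
  rw [du_κD]
  have h1 : (P.Mρ * P.emax + P.Me) * P.βc = P.κD * P.emin / 4 := P.smaxc_mul_βc
  have e2 := (P.e_bounds _ P.hDu_win).2
  have hb : (1 + P.κD * e P.hDu - P.κD * P.emin / 4 - (1 + P.κD * P.emin / 4)) / P.lam ≤ P.κD * P.emax / P.lam :=
    div_le_div_of_nonneg_right (by nlinarith [P.κD_pos, P.emin_pos]) P.lam_pos.le
  rw [h1]; linarith [P.κD_emax_div_lam_le, P.half_lt_full, P.hDu_sub_hA_ge]

/-! ### The two halves -/

/-- Below `hclu` the finger height is the lower fingertip height. [folklore] -/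
theorem yF_eq_lo {h : ℝ} (hh : h ≤ (P.loop2 he).hclu) : P.yF he h = (P.fingerLo he).fingerHyp.y h := by
  rw [K1Loop2Data.FingerAngleData.fingerHyp_y, yF, (P.loop2 he).rstar_of_le_hclu hh]; rfl

/-- Above `hcl` the finger height is minus the reflected upper fingertip height. [folklore] -/
theorem yF_eq_up {h : ℝ} (hh : (P.loop2 he).hcl ≤ h) :
    P.yF he h = -(K1Loop2Data.FingerAngleDataUp.fingerHypUp (P.fingerUp he)).y (-h) := by
  rw [K1Loop2Data.FingerAngleDataUp.fingerHypUp_y, neg_neg, neg_neg, yF, (P.loop2 he).rstar_of_ge_hcl hh]; rfl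

/-- On `[h_D, h_A]`: negative derivative (lower fingertip). [folklore] -/
theorem yF_piece_lo {h : ℝ} (hh : h ∈ Icc P.hD P.hA) :
    ∃ g : ℝ → ℝ, ∃ g' : ℝ, P.yF he =ᶠ[𝓝 h] g ∧ HasDerivAt g g' h ∧ g' < 0 := by
  set F := (P.fingerLo he).fingerHyp
  have hlt := P.hA_lt_hclu he
  refine ⟨F.y, deriv F.y h, ?_, (F.hasDerivAt_y hh).differentiableAt.hasDerivAt, F.deriv_y_neg hh⟩
  filter_upwards [Iio_mem_nhds (show h < (P.loop2 he).hclu by linarith [hh.2])] with s hs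
  exact P.yF_eq_lo he (le_of_lt hs)

/-- On `[h_A, h_Dᵘ]`: negative derivative (upper fingertip, reflected). [folklore] -/
theorem yF_piece_up {h : ℝ} (hh : h ∈ Icc P.hA P.hDu) :
    ∃ g : ℝ → ℝ, ∃ g' : ℝ, P.yF he =ᶠ[𝓝 h] g ∧ HasDerivAt g g' h ∧ g' < 0 := by
  set F := K1Loop2Data.FingerAngleDataUp.fingerHypUp (P.fingerUp he)
  have hlt := P.hcl_lt_hA he
  have hm : -h ∈ Icc F.hD F.hA := ⟨by show -P.hDu ≤ -h; linarith [hh.2], by show -h ≤ -P.hA; linarith [hh.1]⟩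
  have hd : HasDerivAt F.y (deriv F.y (-h)) (-h) := (F.hasDerivAt_y hm).differentiableAt.hasDerivAt
  have hneg : deriv F.y (-h) < 0 := F.deriv_y_neg hm
  have hcomp : HasDerivAt (fun s ↦ -F.y (-s)) (-(deriv F.y (-h) * -1)) h := (hd.comp h (hasDerivAt_neg h)).neg
  refine ⟨fun s ↦ -F.y (-s), _, ?_, hcomp, by nlinarith⟩
  filter_upwards [Ioi_mem_nhds (show (P.loop2 he).hcl < h by linarith [hh.1])] with s hs
  exact P.yF_eq_up he (le_of_lt hs)

/-! ### Smoothness at the tips and the stubs -/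

/-- The finger height is `C^∞` at every `h ∈ (0.15, 0.85)` with `Θlo h ∈ (-π, π)`. [folklore] -/
theorem contDiffAt_yF {h : ℝ} (hh : h ∈ Ioo (0.15 : ℝ) 0.85) (hθ : P.Θlo h ∈ Ioo (-π) π) : ContDiffAt ℝ ∞ (P.yF he) h := by
  set L := P.loop2 he
  have hr : ContDiffAt ℝ ∞ L.rstar h := L.contDiff_rstar.contDiffAt
  have hΘ : ContDiffAt ℝ ∞ P.Θlo h := by
    have : P.Θlo = fun y ↦ c.ΘB y - P.φ := rfl
    rw [this]
    exact ((contDiffOn_ΘB c).contDiffAt (Ioo_mem_nhds (by linarith [hh.1]) (by linarith [hh.2]))).sub contDiffAt_const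
  have htw : ContDiffAt ℝ ∞ (fun p : ℝ × ℝ ↦ twistAngle P.tw p.1 p.2) (L.rstar h, P.Θlo h) :=
    (contDiffOn_twistAngle P.tw).contDiffAt ((isOpen_univ.prod isOpen_Ioo).mem_nhds (Set.mk_mem_prod (mem_univ _) hθ))
  have hα : ContDiffAt ℝ ∞ ((fun p : ℝ × ℝ ↦ twistAngle P.tw p.1 p.2) ∘ fun s ↦ (L.rstar s, P.Θlo s)) h :=
    htw.comp h (hr.prodMk hΘ)
  exact hr.mul (contDiff_sin.contDiffAt.comp h hα)

/-- `Θlo_mem_tips` (auxiliary). [folklore] -/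
theorem Θlo_mem_tips {h : ℝ} (hh : h ∈ Icc P.hD P.hDu) : P.Θlo h ∈ Icc (-P.θDu) P.θD := by
  have hanti : AntitoneOn P.Θlo (Icc (10⁻¹ : ℝ) (9 / 10)) := by
    intro x hx y hy hxy
    show c.ΘB y - P.φ ≤ c.ΘB x - P.φ
    have := c.strictAntiOn_ΘB.antitoneOn hx hy hxy
    linarith
  have hD := P.hD_mem'; have hDu := P.hDu_mem'
  have h1 : P.Θlo h ≤ P.Θlo P.hD := hanti ⟨by linarith [hD.1], by linarith [hD.2]⟩ ⟨by linarith [hh.1, hD.1], by linarith [hh.2, hDu.2]⟩ hh.1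
  have h2 : P.Θlo P.hDu ≤ P.Θlo h := hanti ⟨by linarith [hh.1, hD.1], by linarith [hh.2, hDu.2]⟩ ⟨by linarith [hDu.1], by linarith [hDu.2]⟩ hh.2
  rw [P.Θlo_hD] at h1; rw [P.Θlo_hDu_val] at h2
  exact ⟨h2, h1⟩

/-- `Θlo_mem_Ioo_tips` (auxiliary). [folklore] -/
theorem Θlo_mem_Ioo_tips {h : ℝ} (hh : h ∈ Icc P.hD P.hDu) : P.Θlo h ∈ Ioo (-π) π := by
  have h := P.Θlo_mem_tips hh; have h1 := P.θD_mem.2; have h2 := P.θDu_mem.2; have := c.θlow_pos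
  exact ⟨by linarith [h.1], by linarith [h.2]⟩

/-- **A stub beyond a tip**: if `yF` is `C^∞` at `h₀` with negative derivative there, the derivative
stays negative on a neighbourhood. [folklore] -/
theorem exists_stub_yF {h₀ : ℝ} (hcd : ContDiffAt ℝ ∞ (P.yF he) h₀) (hneg : deriv (P.yF he) h₀ < 0) :
    ∃ η > 0, ∀ h ∈ Ioo (h₀ - η) (h₀ + η), HasDerivAt (P.yF he) (deriv (P.yF he) h) h ∧ deriv (P.yF he) h < 0 := by
  have hcont : ContinuousAt (deriv (P.yF he)) h₀ := ContDiffAt.continuousAt_deriv_real hcd (by simp)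
  have hev1 : ∀ᶠ h in 𝓝 h₀, deriv (P.yF he) h < 0 := hcont.eventually (gt_mem_nhds hneg)
  have hev2 : ∀ᶠ h in 𝓝 h₀, DifferentiableAt ℝ (P.yF he) h := by
    have h2 : ContDiffAt ℝ 2 (P.yF he) h₀ := hcd.of_le (WithTop.coe_le_coe.2 le_top)
    exact (h2.eventually (by simp)).mono fun h hh ↦ hh.differentiableAt (by simp)
  obtain ⟨η, hη, hball⟩ := Metric.eventually_nhds_iff.1 (hev1.and hev2)
  refine ⟨η, hη, fun h hh ↦ ?_⟩
  have hb : dist h h₀ < η := by rw [Real.dist_eq, abs_lt]; constructor <;> linarith [hh.1, hh.2]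
  exact ⟨(hball hb).2.hasDerivAt, (hball hb).1⟩

/-- **The finger height is strictly decreasing across the slab**: for some `η > 0`, negative
derivative and strict decrease on `[h_D - η, h_Dᵘ + η]`. [cite: Kirby1989, Ch. I §4] -/
theorem yF_strictAnti : ∃ η > 0, (∀ h ∈ Icc (P.hD - η) (P.hDu + η),
    HasDerivAt (P.yF he) (deriv (P.yF he) h) h ∧ deriv (P.yF he) h < 0) ∧
    StrictAntiOn (P.yF he) (Icc (P.hD - η) (P.hDu + η)) := by
  have hD := P.hD_mem'; have hDu := P.hDu_mem'; have hDlt := P.hD_lt_hDu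
  have hAm := P.hA_mem
  -- derivative facts on `[h_D, h_Dᵘ]`
  have hmid : ∀ h ∈ Icc P.hD P.hDu, HasDerivAt (P.yF he) (deriv (P.yF he) h) h ∧ deriv (P.yF he) h < 0 := by
    intro h hh
    obtain ⟨g, g', hg, hd, hneg⟩ := if hle : h ≤ P.hA then P.yF_piece_lo he ⟨hh.1, hle⟩
      else P.yF_piece_up he ⟨(lt_of_not_ge hle).le, hh.2⟩
    have hy : HasDerivAt (P.yF he) g' h := hd.congr_of_eventuallyEq hg
    rw [hy.deriv]; exact ⟨hy, hneg⟩
  -- stubs at the two tips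
  have hcd1 := P.contDiffAt_yF he (h := P.hD) ⟨by linarith [hD.1], by linarith [hD.2]⟩ (P.Θlo_mem_Ioo_tips ⟨le_rfl, hDlt.le⟩)
  have hcd2 := P.contDiffAt_yF he (h := P.hDu) ⟨by linarith [hDu.1], by linarith [hDu.2]⟩ (P.Θlo_mem_Ioo_tips ⟨hDlt.le, le_rfl⟩)
  obtain ⟨η₁, hη₁, hst1⟩ := P.exists_stub_yF he hcd1 (hmid _ ⟨le_rfl, hDlt.le⟩).2
  obtain ⟨η₂, hη₂, hst2⟩ := P.exists_stub_yF he hcd2 (hmid _ ⟨hDlt.le, le_rfl⟩).2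
  refine ⟨min η₁ η₂ / 2, by positivity, ?_⟩
  have hm1 := min_le_left η₁ η₂; have hm2 := min_le_right η₁ η₂
  have hall : ∀ h ∈ Icc (P.hD - min η₁ η₂ / 2) (P.hDu + min η₁ η₂ / 2),
      HasDerivAt (P.yF he) (deriv (P.yF he) h) h ∧ deriv (P.yF he) h < 0 := by
    intro h hh
    rcases lt_or_ge h P.hD with h1 | h1
    · exact hst1 h ⟨by linarith [hh.1], by linarith⟩
    rcases le_or_gt h P.hDu with h2 | h2
    · exact hmid h ⟨h1, h2⟩
    · exact hst2 h ⟨by linarith, by linarith [hh.2]⟩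
  exact ⟨hall, (strictAntiOn_of_local_pieces fun s hs ↦ ⟨P.yF he, _, EventuallyEq.rfl, hall s hs⟩).2⟩

/-- The finger height at the two tips. [folklore] -/
theorem yF_hD : P.yF he P.hD = P.rD := by
  rw [P.yF_eq_lo he (by have := (P.loop2 he).hcl_le_hclu; linarith [P.hcl_lt_hA he, P.hA_lt_hclu he, P.hA_mem.1])]
  exact (P.fingerLo he).fingerHyp.y_hD

/-- `yF_hDu` (auxiliary). [folklore] -/
theorem yF_hDu : P.yF he P.hDu = -P.rDu := by
  rw [P.yF_eq_up he (by linarith [P.hcl_lt_hA he, P.hA_mem.2])]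
  have h := (K1Loop2Data.FingerAngleDataUp.fingerHypUp (P.fingerUp he)).y_hD
  have e1 : (K1Loop2Data.FingerAngleDataUp.fingerHypUp (P.fingerUp he)).hD = -P.hDu := rfl
  have e2 : (K1Loop2Data.FingerAngleDataUp.fingerHypUp (P.fingerUp he)).rD = P.rDu := rfl
  rw [e1, e2] at h
  rw [h]

end SlideChoice

end BandCore

end Literature.Topology.FourManifolds
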